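import Literature.NumberTheory.EllipticCurves.PlusMinusPAdicLFunctionProofs
import Literature.NumberTheory.EllipticCurves.Kobayashi2003.SignedKatoDivisibility
import Literature.NumberTheory.EllipticCurves.GreenbergVatsal2000.CongruentCurves
import Literature.NumberTheory.EllipticCurves.PAdicBSD
import Literature.NumberTheory.EllipticCurves.Sprung2017.ChromaticLimitCongruenceProofs
import Summits.BirchSwinnertonDyer.Rank1Residual.Supersingular.MazurTateLayerConsistency
import Mathlib.Algebra.CharP.Lemmas
import HarnessLib

/-!
# Route `SignedLowerHalves`, crux `KobayashiMainConjectureSmallImage` (item stmt-BirchSwinnertonDyer-19002),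
# line `birth_acns`, stub `stub_muOneSign_ns` (the one-sign μ-rider): the KERNEL REDUCTION
# «`μ(L_p^ε) > 0` ⇒ every Mazur–Tate coefficient of parity `ε` is divisible by `p`», i.e.
# the rider from ONE unit orbit sum (cell `bsd-ssimc`, seat `bsd-line-slh-p3` gen 8; THEOREMS ONLY; helper)

WHAT. For an odd prime `p`, a rational weight-2 newform `f` of level `N` prime to `p` with `a_p(f) = 0`, and
ANY `L ∈ Λ = ℤ_p⟦T⟧` satisfying Pollack's congruence `θ_n ≡ ω · L (mod ω_n)` of the tree
(`IsCongrModOmega`, stated in `Λ ⊗ ℚ_p` with an unknown `p^m`): if `L` has NO unit content (`μ(L) > 0`,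
`¬ HasUnitContent L`) then EVERY coefficient of the Mazur–Tate element `θ_n(f)` written in the group-ring basis
`(1+T)^s` — i.e. every ω⁰ orbit sum `Σ_η [η γ^s / p^{n+1}]⁺_f` over the Teichmüller representatives `η` — has
`p`-adic norm `< 1` (`norm_coeff_comp_mazurTateElement_lt_one_of_not_hasUnitContent`). The `p^m` of the rational
congruence is harmless: `θ_n ∈ ℤ_p[T]` (tree theorem `exists_map_eq_map_mazurTateElement`, from the Eisenstein
number `−(p+1)`), `ω_n` is monic, and `Λ/pΛ = 𝔽_p⟦T⟧` is a domain, so `p^m · D ∈ ω_n Λ ⇒ D ∈ ω_n Λ`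
(`exists_eq_coe_mul_of_C_pow_mul_eq`); then `θ_n ≡ 0 (mod (p, ω_n))` with `ω_n ≡ T^{p^n} (mod p)` and
`deg θ_n < p^n` force `θ_n ≡ 0 (mod p)`. Contrapositive = the CERTIFICATE form of the rider
(`exists_isSignedPAdicLFunction_hasUnitContent_of_norm_coeff_eq_one`): ONE coefficient of ONE `θ_n` of parity `ε`
which is a `p`-adic unit gives `∃ L, IsSignedPAdicLFunction f p ε L ∧ HasUnitContent L` (existence by the tree
THEOREM `pollack_exists_plusMinusPAdicLFunction_holds`). This is the trivial direction of the Kurihara /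
Perrin-Riou stabilisation `μ(θ_n) = μ(L^ε)` (Pollack–Weston 2011 Thm. 4.1 (1)); no `λ`-information is needed
(contrast the cell's TIGHT Mazur–Tate rows, which pin `λ` as well through the rational congruence).

WHY (line `birth_acns`, stub `stub_muOneSign_ns`, ideator bsd-idea-13 g8's `EG-REDUCTION-g8.md`): at `p = 3` the
orbit sums are `[a/3^{n+1}]⁺ + [−a/3^{n+1}]⁺ = 2[a/3^{n+1}]⁺`, so «both `L₃^±` without unit content» forces EVERY
plus symbol `[a/3^{n+1}]⁺_f` (`3 ∤ a`, `n ≥ 0`) to vanish mod `3` — the hypothesis refuted by the ideator's LEMMA′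
(Venkataramana 1994 / Vaserstein 1972 + Serre 1970 CSP + the kernel-checked coset lemma) and the Hecke identity
at `ℓ = p`; this file is the kernel half «signed `μ` ⇒ symbols» of that road, for every odd `p`. At `p ≥ 5` it
turns the rider into a per-pair certificate: one unit orbit sum.

HONEST SCOPE: conditional on nothing (all inputs are theorems of the tree); proves no stub by itself (the
non-vanishing of one orbit sum is the open / per-pair input); crux 4 OPEN; BSD is not proved by any of this.

References: [Pollack2003] Thm. 5.6, Prop. 6.18; [PollackWeston2011] Thm. 4.1 (1) (the direction used here is
elementary); [Kobayashi2003] Thm. 3.2, (3.4)–(3.5); tree `PlusMinusPAdicLFunctionProofs` (integral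
reconstruction of `L^±`).
-/

-- D-0017: single-problem summit, the namespace repeats the problem name by design.
set_option linter.dupNamespace false
set_option autoImplicit false

noncomputable section

open scoped Classical

open Polynomial Literature.NumberTheory.EllipticCurves Literature.NumberTheory.EllipticCurves.ModularForms
  Literature.NumberTheory.EllipticCurves.Kobayashi2003 Literature.NumberTheory.EllipticCurves.GreenbergVatsal2000
  CongruenceSubgroup

namespace Summit.BirchSwinnertonDyer.BirchSwinnertonDyer.Theorems.SmallImageOrbitSumMu

variable {p : ℕ} [Fact p.Prime]

/-! ## §1 Commutative algebra in `Λ = ℤ_p⟦T⟧`: `p` is prime to every monic polynomial -/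

/-- **Cancelling `p^m` against a monic polynomial in `Λ`**: if `p^m · E = D · q` with `D` monic, then `E = D · q'`
for some `q' ∈ Λ` (`Λ/DΛ` has no `p`-torsion). [folklore] -/
theorem exists_eq_coe_mul_of_C_pow_mul_eq {D : ℤ_[p][X]} (hD : D.Monic) :
    ∀ (m : ℕ) {E q : PowerSeries ℤ_[p]},
      PowerSeries.C ((p : ℤ_[p]) ^ m) * E = (D : PowerSeries ℤ_[p]) * q → ∃ q' : PowerSeries ℤ_[p], E = D * q' := by
  intro m
  induction m with
  | zero =>
    intro E q h
    exact ⟨q, by rwa [pow_zero, map_one, one_mul] at h⟩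
  | succ m ih =>
    intro E q h
    have hdvd : PowerSeries.C (p : ℤ_[p]) ∣ (D : PowerSeries ℤ_[p]) * q := by
      rw [← h, pow_succ, map_mul]
      exact ⟨PowerSeries.C ((p : ℤ_[p]) ^ m) * E, by ring⟩
    obtain ⟨q₁, hq₁⟩ := Sprung2017.C_dvd_of_C_dvd_coe_mul hD hdvd
    refine ih (q := q₁) ?_
    have hp0 : (PowerSeries.C (p : ℤ_[p])) ≠ 0 := by
      rw [Ne, PowerSeries.ext_iff, not_forall]
      refine ⟨0, ?_⟩
      rw [PowerSeries.coeff_C, if_pos rfl, map_zero]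
      exact_mod_cast (Fact.out : p.Prime).ne_zero
    apply mul_left_cancel₀ hp0
    rw [hq₁] at h
    calc PowerSeries.C (p : ℤ_[p]) * (PowerSeries.C ((p : ℤ_[p]) ^ m) * E)
        = PowerSeries.C ((p : ℤ_[p]) ^ (m + 1)) * E := by rw [pow_succ, map_mul]; ring
      _ = (D : PowerSeries ℤ_[p]) * (PowerSeries.C (p : ℤ_[p]) * q₁) := h
      _ = PowerSeries.C (p : ℤ_[p]) * ((D : PowerSeries ℤ_[p]) * q₁) := by ring

/-- **`ω_n ≡ T^{p^n} (mod p)`**: the reduction of `ω_n = (1+T)^{p^n} − 1` modulo `p` is `T^{p^n}` (freshman's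
dream in characteristic `p`). [folklore] -/
theorem map_toZMod_cyclotomicOmega (n : ℕ) :
    ((cyclotomicOmega p n).map (Int.castRingHom ℤ_[p])).map (PadicInt.toZMod (p := p)) = X ^ p ^ n := by
  simp only [cyclotomicOmega, Polynomial.map_sub, Polynomial.map_pow, Polynomial.map_add, Polynomial.map_X,
    Polynomial.map_one]
  rw [add_pow_char_pow, one_pow, add_sub_cancel_right]

/-- **A polynomial of degree `< p^n` which is `≡ 0 (mod (p, ω_n))` in `Λ` is `≡ 0 (mod p)`**: if
`Θ − p·E ∈ ω_n Λ` with `deg Θ < p^n`, then every coefficient of `Θ` is divisible by `p`. [folklore] -/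
theorem map_toZMod_eq_zero_of_sub_mem {n : ℕ} {Θ : ℤ_[p][X]} (hdeg : Θ.natDegree < p ^ n)
    {E q : PowerSeries ℤ_[p]}
    (h : (Θ : PowerSeries ℤ_[p]) - PowerSeries.C (p : ℤ_[p]) * E =
      (((cyclotomicOmega p n).map (Int.castRingHom ℤ_[p]) : ℤ_[p][X]) : PowerSeries ℤ_[p]) * q) :
    Θ.map (PadicInt.toZMod (p := p)) = 0 := by
  -- reduce the identity modulo `p`: `Θ̄ = T^{p^n} · q̄` in `𝔽_p⟦T⟧`
  have hred := congr_arg (PowerSeries.map (PadicInt.toZMod (p := p))) h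
  have hC : PowerSeries.map (PadicInt.toZMod (p := p)) (PowerSeries.C (p : ℤ_[p]) * E) = 0 :=
    (Sprung2017.C_prime_dvd_iff_map_toZMod_eq_zero _).mp (Dvd.intro _ rfl)
  rw [map_sub, hC, sub_zero, map_mul, ← Polynomial.polynomial_map_coe, ← Polynomial.polynomial_map_coe,
    map_toZMod_cyclotomicOmega, Polynomial.coe_pow, Polynomial.coe_X] at hred
  -- `T^{p^n} ∣ Θ̄` and `deg Θ̄ < p^n` give `Θ̄ = 0`
  apply Polynomial.coe_injective
  rw [Polynomial.coe_zero]
  ext k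
  rw [map_zero]
  by_cases hk : k < p ^ n
  · have hX : (PowerSeries.X : PowerSeries (ZMod p)) ^ p ^ n ∣
        ((Θ.map (PadicInt.toZMod (p := p)) : (ZMod p)[X]) : PowerSeries (ZMod p)) :=
      ⟨_, hred⟩
    exact (PowerSeries.X_pow_dvd_iff.mp hX) k hk
  · rw [Polynomial.coeff_coe]
    refine Polynomial.coeff_eq_zero_of_natDegree_lt (lt_of_lt_of_le ?_ (not_lt.mp hk))
    exact lt_of_le_of_lt (Polynomial.natDegree_map_le) hdeg

/-! ## §2 `μ(L) > 0` ⇒ all group-ring coefficients of `θ_n` are divisible by `p` -/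

section Main

variable {N : ℕ} [NeZero N] {f : CuspForm (Gamma0 N) 2}

/-- **The reduction.** `p` odd, `f` a rational newform of level `N` with `p ∤ N` and `a_p(f) = 0`; `L ∈ Λ` with
Pollack's congruence `θ_n ≡ ω L (mod ω_n)` at level `n` (any `ω ∈ ℤ[T]`, congruence in `Λ ⊗ ℚ_p`) and WITHOUT
unit content. Then every coefficient of `θ_n(f)` in the basis `(1+T)^s` — the coefficient of `T^s` of
`θ_n ∘ (T − 1)`, which is the ω⁰ orbit sum `Σ_η [η γ^s/p^{n+1}]⁺_f` — has `p`-adic norm `< 1`.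
[cite: Pollack2003, Prop. 6.18] [cite: PollackWeston2011, Thm. 4.1 (1)] -/
theorem norm_coeff_comp_mazurTateElement_lt_one_of_not_hasUnitContent (hp2 : p ≠ 2) (hf0 : IsNewform0 f)
    (hpN : ¬ p ∣ N) (hap : cuspCoeff f p = ((0 : ℤ) : ℂ)) {n : ℕ} {ω : ℤ[X]} {L : IwasawaAlgebra p}
    (hL : IsCongrModOmega p n (mazurTateElement f p n) ω L) (hμ : ¬ HasUnitContent L) (s : ℕ) :
    ‖((((mazurTateElement f p n).comp (X - 1)).coeff s : ℚ) : ℚ_[p])‖ < 1 := by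
  -- `θ_n ∈ ℤ_p[T]`
  obtain ⟨Θ, hΘ⟩ := exists_map_eq_map_mazurTateElement hp2 hf0 hpN hap n
  -- `L = p · L'`
  obtain ⟨L', hL'⟩ : PowerSeries.C (p : ℤ_[p]) ∣ L :=
    not_not.mp (mt (hasUnitContent_iff_not_C_dvd L).mpr hμ)
  -- the rational congruence, pulled back to `Λ`
  obtain ⟨m, q, hmq⟩ := hL
  set Ωn : ℤ_[p][X] := (cyclotomicOmega p n).map (Int.castRingHom ℤ_[p]) with hΩn
  set ωp : ℤ_[p][X] := ω.map (Int.castRingHom ℤ_[p]) with hωp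
  have hθ : (((mazurTateElement f p n).map (algebraMap ℚ ℚ_[p]) : ℚ_[p][X]) : PowerSeries ℚ_[p]) =
      iwasawaToPowerSeries p (Θ : PowerSeries ℤ_[p]) := by
    rw [← hΘ, Polynomial.polynomial_map_coe]
  have hCm : PowerSeries.C ((p : ℚ_[p]) ^ m) = iwasawaToPowerSeries p (PowerSeries.C ((p : ℤ_[p]) ^ m)) := by
    show _ = PowerSeries.map (algebraMap ℤ_[p] ℚ_[p]) _
    rw [PowerSeries.map_C, map_pow (algebraMap ℤ_[p] ℚ_[p]), map_natCast (algebraMap ℤ_[p] ℚ_[p])]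
  rw [hθ, hCm, ← map_sub, ← map_mul] at hmq
  have hΛ : PowerSeries.C ((p : ℤ_[p]) ^ m) * ((Θ : PowerSeries ℤ_[p]) - (ωp : PowerSeries ℤ_[p]) * L) =
      (Ωn : PowerSeries ℤ_[p]) * q := iwasawaToPowerSeries_injective p hmq
  -- cancel `p^m`
  obtain ⟨q', hq'⟩ := exists_eq_coe_mul_of_C_pow_mul_eq (monic_cyclotomicOmega p n |>.map _) m hΛ
  -- `Θ − p·(ω L') ∈ ω_n Λ`, `deg Θ < p^n` ⇒ `Θ ≡ 0 (mod p)`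
  have hdegΘ : Θ.natDegree < p ^ n := by
    have h1 : Θ.natDegree = (Θ.map (algebraMap ℤ_[p] ℚ_[p])).natDegree :=
      (Polynomial.natDegree_map_eq_of_injective (IsFractionRing.injective ℤ_[p] ℚ_[p]) _).symm
    rw [h1, hΘ]
    exact lt_of_le_of_lt Polynomial.natDegree_map_le
      (Summit.BirchSwinnertonDyer.Rank1Residual.Supersingular.natDegree_mazurTateElement_lt f p n)
  have hsub : (Θ : PowerSeries ℤ_[p]) - PowerSeries.C (p : ℤ_[p]) * ((ωp : PowerSeries ℤ_[p]) * L') =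
      (Ωn : PowerSeries ℤ_[p]) * q' := by
    rw [← hq', hL']
    ring
  have hΘ0 : Θ.map (PadicInt.toZMod (p := p)) = 0 := map_toZMod_eq_zero_of_sub_mem hdegΘ hsub
  -- the `s`-th group-ring coefficient
  have hcoeff : (p : ℤ_[p]) ∣ (Θ.comp (X - 1)).coeff s := by
    have h1 : (Θ.comp (X - 1)).map (PadicInt.toZMod (p := p)) = 0 := by
      rw [Polynomial.map_comp, hΘ0, Polynomial.zero_comp]
    have h2 := congr_arg (fun P : (ZMod p)[X] ↦ P.coeff s) h1
    simp only [Polynomial.coeff_map, Polynomial.coeff_zero] at h2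
    rwa [← RingHom.mem_ker, PadicInt.ker_toZMod, PadicInt.maximalIdeal_eq_span_p,
      Ideal.mem_span_singleton] at h2
  have hcast : ((((mazurTateElement f p n).comp (X - 1)).coeff s : ℚ) : ℚ_[p]) =
      (((Θ.comp (X - 1)).coeff s : ℤ_[p]) : ℚ_[p]) := by
    have h1 : ((((mazurTateElement f p n).comp (X - 1)).coeff s : ℚ) : ℚ_[p]) =
        ((Θ.map (algebraMap ℤ_[p] ℚ_[p])).comp (X - 1)).coeff s := by
      rw [hΘ, ← eq_ratCast (algebraMap ℚ ℚ_[p]), ← Polynomial.coeff_map, Polynomial.map_comp,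
        Polynomial.map_sub, Polynomial.map_X, Polynomial.map_one]
    have h2 : ((Θ.map (algebraMap ℤ_[p] ℚ_[p])).comp (X - 1)).coeff s =
        algebraMap ℤ_[p] ℚ_[p] ((Θ.comp (X - 1)).coeff s) := by
      rw [← Polynomial.coeff_map, Polynomial.map_comp, Polynomial.map_sub, Polynomial.map_X,
        Polynomial.map_one]
    rw [h1, h2, PadicInt.algebraMap_apply]
  rw [hcast, PadicInt.padic_norm_e_of_padicInt, PadicInt.norm_lt_one_iff_dvd]
  exact hcoeff

/-- **Signed form**: for `L = L_p^ε` in Kobayashi's labelling at a level `n` of its parity (`ε = 1` and `n` even —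
the tree's / Pollack's `L⁻` —, or `ε = −1` and `n` odd — `L⁺`), `IsSignedPAdicLFunction f p ε L` without unit content
forces every group-ring coefficient of `θ_n` to have norm `< 1`.
[cite: Kobayashi2003, Thm. 3.2 and (3.4)–(3.5)] [cite: PollackWeston2011, Thm. 4.1 (1)] -/
theorem norm_coeff_comp_mazurTateElement_lt_one_of_isSignedPAdicLFunction (hp2 : p ≠ 2) (hf0 : IsNewform0 f)
    (hpN : ¬ p ∣ N) (hap : cuspCoeff f p = ((0 : ℤ) : ℂ)) {n : ℕ} {ε : ℤˣ}
    (hε : (Even n ∧ ε = 1) ∨ (Odd n ∧ ε = -1)) {L : IwasawaAlgebra p}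
    (hL : IsSignedPAdicLFunction f p ε L) (hμ : ¬ HasUnitContent L) (s : ℕ) :
    ‖((((mazurTateElement f p n).comp (X - 1)).coeff s : ℚ) : ℚ_[p])‖ < 1 := by
  rcases hε with ⟨hn, rfl⟩ | ⟨hn, rfl⟩
  · rw [isSignedPAdicLFunction_one_iff] at hL
    exact norm_coeff_comp_mazurTateElement_lt_one_of_not_hasUnitContent hp2 hf0 hpN hap (hL n hn) hμ s
  · rw [isSignedPAdicLFunction_neg_one_iff] at hL
    exact norm_coeff_comp_mazurTateElement_lt_one_of_not_hasUnitContent hp2 hf0 hpN hap (hL n hn) hμ s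

/-- **The rider from ONE unit orbit sum (certificate form of `stub_muOneSign_ns`).** `p` odd, `W/ℚ` globally
minimal with good reduction at `p` and `a_p = 0`, `f` its newform (any level); `ε = 1` with `n` even, or `ε = −1`
with `n` odd. If for some `s` the group-ring coefficient `coeff_s(θ_n ∘ (T−1)) = Σ_η [η γ^s/p^{n+1}]⁺_f` is a `p`-adic
UNIT, then Kobayashi's `L_p^ε` exists (tree THEOREM `pollack_exists_plusMinusPAdicLFunction_holds`) and has unit
content: `∃ L, IsSignedPAdicLFunction f p ε L ∧ HasUnitContent L`.
[cite: Pollack2003, Thm. 5.6 and Prop. 6.18] [cite: PollackWeston2011, Thm. 4.1 (1)] -/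
theorem exists_isSignedPAdicLFunction_hasUnitContent_of_norm_coeff_eq_one {W : WeierstrassCurve ℚ}
    [W.IsElliptic] [W.IsGloballyMinimal] (hp2 : p ≠ 2) (hf : IsNewformOf W f)
    (hgood : W.HasGoodReductionAtPrime p) (hap : W.frobeniusTrace p = 0) {n s : ℕ} {ε : ℤˣ}
    (hε : (Even n ∧ ε = 1) ∨ (Odd n ∧ ε = -1))
    (hunit : ‖((((mazurTateElement f p n).comp (X - 1)).coeff s : ℚ) : ℚ_[p])‖ = 1) :
    ∃ L : IwasawaAlgebra p, IsSignedPAdicLFunction f p ε L ∧ HasUnitContent L := by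
  obtain ⟨L, -, hL⟩ := exists_isSignedPAdicLFunction (pollack_exists_plusMinusPAdicLFunction_holds) hp2 hf
    hgood hap ε
  refine ⟨L, hL, ?_⟩
  by_contra hμ
  have hpN : ¬ p ∣ N := not_dvd_level_of_isNewformOf hf hgood
  have hap' : cuspCoeff f p = ((0 : ℤ) : ℂ) := by
    rw [cuspCoeff_eq_frobeniusTrace_of_isNewformOf_holds hf hgood, hap]
  have h := norm_coeff_comp_mazurTateElement_lt_one_of_isSignedPAdicLFunction hp2 hf.1 hpN hap' hε hL hμ s
  rw [hunit] at h
  exact lt_irrefl _ h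

/-- **Every signed function of that sign then has unit content** (the `∀ L` form used by certificate consumers;
uniqueness of `L_p^ε` is `Kobayashi2003.existsUnique_isSignedPAdicLFunction`, not needed for the proof).
[cite: Kobayashi2003, Thm. 3.2] [cite: PollackWeston2011, Thm. 4.1 (1)] -/
theorem hasUnitContent_of_isSignedPAdicLFunction_of_norm_coeff_eq_one {W : WeierstrassCurve ℚ}
    [W.IsElliptic] [W.IsGloballyMinimal] (hp2 : p ≠ 2) (hf : IsNewformOf W f)
    (hgood : W.HasGoodReductionAtPrime p) (hap : W.frobeniusTrace p = 0) {n s : ℕ} {ε : ℤˣ}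
    (hε : (Even n ∧ ε = 1) ∨ (Odd n ∧ ε = -1))
    (hunit : ‖((((mazurTateElement f p n).comp (X - 1)).coeff s : ℚ) : ℚ_[p])‖ = 1)
    {L : IwasawaAlgebra p} (hL : IsSignedPAdicLFunction f p ε L) : HasUnitContent L := by
  by_contra hμ
  have hpN : ¬ p ∣ N := not_dvd_level_of_isNewformOf hf hgood
  have hap' : cuspCoeff f p = ((0 : ℤ) : ℂ) := by
    rw [cuspCoeff_eq_frobeniusTrace_of_isNewformOf_holds hf hgood, hap]
  have h := norm_coeff_comp_mazurTateElement_lt_one_of_isSignedPAdicLFunction hp2 hf.1 hpN hap' hε hL hμ s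
  rw [hunit] at h
  exact lt_irrefl _ h

/-- **Both signs at once (the shape of `stub_muOneSign_ns`).** If NO signed function of `f` at `p` has unit content
(`μ(L_p^+) > 0` and `μ(L_p^−) > 0`), then at EVERY level `n` every group-ring coefficient of `θ_n(f)` has norm `< 1`;
equivalently, one unit coefficient at one level yields `∃ ε L, IsSignedPAdicLFunction f p ε L ∧ HasUnitContent L`.
[cite: PollackWeston2011, Thm. 4.1 (1) and Remark 4.2] -/
theorem exists_sign_hasUnitContent_of_norm_coeff_eq_one {W : WeierstrassCurve ℚ}
    [W.IsElliptic] [W.IsGloballyMinimal] (hp2 : p ≠ 2) (hf : IsNewformOf W f)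
    (hgood : W.HasGoodReductionAtPrime p) (hap : W.frobeniusTrace p = 0) {n s : ℕ}
    (hunit : ‖((((mazurTateElement f p n).comp (X - 1)).coeff s : ℚ) : ℚ_[p])‖ = 1) :
    ∃ (ε : ℤˣ) (L : IwasawaAlgebra p), IsSignedPAdicLFunction f p ε L ∧ HasUnitContent L := by
  rcases Nat.even_or_odd n with hn | hn
  · exact ⟨1, exists_isSignedPAdicLFunction_hasUnitContent_of_norm_coeff_eq_one hp2 hf hgood hap
      (Or.inl ⟨hn, rfl⟩) hunit⟩
  · exact ⟨-1, exists_isSignedPAdicLFunction_hasUnitContent_of_norm_coeff_eq_one hp2 hf hgood hap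
      (Or.inr ⟨hn, rfl⟩) hunit⟩

end Main

end Summit.BirchSwinnertonDyer.BirchSwinnertonDyer.Theorems.SmallImageOrbitSumMu

end
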